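import Summits.QuantumAdvantage.QuantumAdvantage.Theorems.CubicForrelationNearExactIsExactTwelveLevelFiveOffFlat

/-!
# Crux `CubicForrelation.NearExactIsExact` (stmt-QuantumAdvantage-14043) — n = 12, level 5 below the second boundary: the residual vanishes
  off the hyperplane (general off-flat energy `< 256`)

Certificate seat `b2b-cforr-cert` (gen 13).  HONEST FRAMING: a lemma (standard axioms) for `tw5_levelFive_window_all`
(`…TwelveLevelFiveEngine.lean`); the same statement as `tw5_off_flat` (`…TwelveLevelFiveOffFlat.lean`, bound `160`) with the off-flat energy
bound relaxed to the natural `< 256`; finite-slice bookkeeping about cubic Boolean pairs on 12 bits, NOT summit progress.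

`tw5_off_flat_lt`: cubic `f, g` on 12 bits, `W_g = 32·u'`, `P = {u' odd}` a coset `x_P ⊕ V` (`V ∋ 0` xor-closed, `#V = 2¹¹`), residual
`e = u' − 2(−1)^f` (even off `P`) with `Σ_{x ∉ P} e² < 256`.  Then `e = 0` off `P`: on the other coset `p ⊕ V` the parametrised 4-, 5- and 7-flat
sums of `e` are `≡ 0 (mod 4 / 8 / 16)` (general flat sums `fs_flat_sum_dvd` of `u = 2u'` and Ax for `(−1)^f`), so by the Reed–Muller distance
on the abstract 11-flat (`ws_erm_round`) `e/2` is odd at `≥ 256` points (cost `≥ 1024`) or even, then `e/4` odd at `≥ 128` points (cost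
`≥ 2048`) or even, then `e/8` odd at `≥ 32` points (cost `≥ 2048`) or even, and finally a single point with `16 ∣ e ≠ 0` costs `256`.

References: J. Ax (1964) / R. J. McEliece (1972); MacWilliams–Sloane (1977) Ch. 13 §3.  Everything below is proved from Mathlib and the tree;
axioms are the standard three.
-/

set_option linter.dupNamespace false -- D-0017: single-problem summit ⇒ `QuantumAdvantage.QuantumAdvantage` by design

noncomputable section

namespace Summit.QuantumAdvantage.QuantumAdvantage.Theorems.CubicForrelation.NearExactIsExact

open Finset
open Literature.Computability.QuantumComplexity
open Literature.Computability.QuantumComplexity.BuzetChailloux (bxor zeroVec bxor_bxor_cancel_left bxor_zeroVec zeroVec_bxor bxor_comm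
  bxor_self twist_zeroVec_right)
open Literature.Computability.QuantumComplexity.Simon (twist_eq_one_or)
open Literature.Computability.QuantumComplexity.DerivativeWalsh (W)

/-! ### Level 5 on 12 bits, step 1: the residual vanishes off the hyperplane -/

/-- **Off the hyperplane the residual vanishes.**  Cubic `f, g` on 12 bits with `W_g = 32u'`; `P = {u' odd}` a coset `x_P ⊕ V` of an
xor-closed `V ∋ 0` with `2¹¹` elements; if the residual `e = u' − 2(−1)^f` has `Σ_{x ∉ P} e(x)² ≤ 160` then `e = 0` off `P` (three rounds of
wild-point parity on the coset `p ⊕ V`, `p ∉ P`: `4 ∣ e` (4-flats), `8 ∣ e` (5-flats), `16 ∣ e` (7-flats), then `256 > bound`);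
general off-flat energy bound `< 256`. [this work] -/
theorem tw5_off_flat_lt (f g : (Fin (6 + 6) → Bool) → Bool) (hf : IsDegLeFun 3 f) (hg : IsDegLeFun 3 g)
    (u' : (Fin (6 + 6) → Bool) → ℤ) (hu' : ∀ x, W (fun y => signOf (g y)) x = (2 : ℝ) ^ 5 * (u' x : ℝ))
    (V : Finset (Fin (6 + 6) → Bool)) (xP : Fin (6 + 6) → Bool) (h0 : zeroVec ∈ V)
    (hadd : ∀ a ∈ V, ∀ b ∈ V, bxor a b ∈ V) (hcardV : #V = 2 ^ 11)
    (hS : (univ.filter fun x : Fin (6 + 6) → Bool => Odd (u' x)) = V.image (bxor xP))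
    (hoff_lt : ∑ x ∈ univ.filter (fun x => x ∉ (univ.filter fun x : Fin (6 + 6) → Bool => Odd (u' x))),
      (u' x - 2 * sZ (f x)) ^ 2 < 256) :
    ∀ y, y ∉ (univ.filter fun x : Fin (6 + 6) → Bool => Odd (u' x)) → u' y - 2 * sZ (f y) = 0 := by
  classical
  set P := univ.filter (fun x : Fin (6 + 6) → Bool => Odd (u' x)) with hPdef
  have hmemP : ∀ x, x ∈ P ↔ Odd (u' x) := fun x => by simp [hPdef]
  set u : (Fin (6 + 6) → Bool) → ℤ := fun x => 2 * u' x with hudef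
  have hu : ∀ x, W (fun y => signOf (g y)) x = (2 : ℝ) ^ 4 * (u x : ℝ) := by
    intro x; rw [hu' x]; simp only [u]; push_cast; ring
  set e : (Fin (6 + 6) → Bool) → ℤ := fun x => u' x - 2 * sZ (f x) with hedef
  show ∀ y, y ∉ P → e y = 0
  have heeven : ∀ x, x ∉ P → Even (e x) := by
    intro x hx
    have hev : Even (u' x) := Int.not_odd_iff_even.1 fun h => hx ((hmemP x).2 h)
    exact Int.even_sub.2 (iff_of_true hev ⟨sZ (f x), two_mul _⟩)
  have hPV' : ∀ x, x ∉ P → ∀ a ∈ V, bxor x a ∉ P := fun x hx a ha => fl1_coset_out' hadd hS hx ha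
  have hcos_out : ∀ p, p ∉ P → ∀ b ∈ V.image (bxor p), b ∉ P := by
    intro p hp b hb
    obtain ⟨v, hv, rfl⟩ := mem_image.1 hb
    exact hPV' p hp v hv
  have hoff_count : ∀ (T : Finset (Fin (6 + 6) → Bool)) (c : ℤ), (∀ x ∈ T, x ∉ P) → (∀ x ∈ T, c ≤ e x ^ 2) →
      c * #T < 256 := by
    intro T c hT hc
    calc c * #T = ∑ x ∈ T, c := by rw [sum_const, nsmul_eq_mul, mul_comm]
      _ ≤ ∑ x ∈ T, e x ^ 2 := sum_le_sum hc
      _ ≤ ∑ x ∈ univ.filter (fun x => x ∉ P), e x ^ 2 :=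
          sum_le_sum_of_subset_of_nonneg (fun x hx => mem_filter.2 ⟨mem_univ _, hT x hx⟩) fun x _ _ => sq_nonneg _
      _ < 256 := hoff_lt
  -- flat sums of `e = u' − 2s`: `4 ∣` on 4-flats, `8 ∣` on 5-flats, `16 ∣` on 7-flats
  have hflat : ∀ (k c : ℕ) (M : ℤ), (2 : ℤ) ^ (c + 1) = 2 * M → 4 + (c + 1) ≤ k + (6 + 6 - k + 2) / 3 → M ∣ 2 * 2 ^ ((k + 2) / 3) →
      ∀ (b : Fin (6 + 6) → Bool) (a : Fin k → Fin (6 + 6) → Bool),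
      M ∣ ∑ ε : Fin k → Bool, e (fun j => b j ^^ decide (Odd #(univ.filter fun i => ε i && a i j))) := by
    intro k c M hM hk hM' b a
    have h1 := fs_flat_sum_dvd (e := c + 1) g u hg hu b a hk
    obtain ⟨zf, hzf⟩ := sl_sum_sZ_flat f hf b a
    have hzf' : ∑ ε : Fin k → Bool, 2 * sZ (f (fun j => b j ^^ decide (Odd #(univ.filter fun i => ε i && a i j)))) =
        2 * 2 ^ ((k + 2) / 3) * zf := by
      rw [← mul_sum, hzf, ← mul_assoc]
    have h1' : 2 * M ∣ 2 * ∑ ε : Fin k → Bool, u' (fun j => b j ^^ decide (Odd #(univ.filter fun i => ε i && a i j))) := by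
      rw [← hM, mul_sum]; exact h1
    have h1'' : M ∣ ∑ ε : Fin k → Bool, u' (fun j => b j ^^ decide (Odd #(univ.filter fun i => ε i && a i j))) :=
      (mul_dvd_mul_iff_left two_ne_zero).1 h1'
    have h3 : ∑ ε : Fin k → Bool, e (fun j => b j ^^ decide (Odd #(univ.filter fun i => ε i && a i j))) =
        ∑ ε : Fin k → Bool, u' (fun j => b j ^^ decide (Odd #(univ.filter fun i => ε i && a i j))) -
        ∑ ε : Fin k → Bool, 2 * sZ (f (fun j => b j ^^ decide (Odd #(univ.filter fun i => ε i && a i j)))) := by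
      rw [← sum_sub_distrib]
    rw [h3, hzf']
    exact dvd_sub h1'' (dvd_mul_of_dvd_left hM' _)
  have hflat4 := hflat 4 2 4 (by norm_num) (by norm_num) (by norm_num)
  have hflat5 := hflat 5 3 8 (by norm_num) (by norm_num) (by norm_num)
  have hflat7 := hflat 7 4 16 (by norm_num) (by norm_num) (by norm_num)
  -- round 1: `4 ∣ e` off `P`
  have hdiv4 : ∀ y, y ∉ P → (4 : ℤ) ∣ e y := by
    by_contra hcon
    push Not at hcon
    obtain ⟨p, hp, hp4⟩ := hcon
    have hp2 : ∀ y, y ∉ P → e y = 2 * (e y / 2) := fun y hy =>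
      (Int.mul_ediv_cancel' (even_iff_two_dvd.1 (heeven y hy))).symm
    rcases ws_erm_round V h0 hadd hcardV p (fun y => e y / 2) 3 (fun b hb a ha => by
        have hpts : ∀ ε : Fin (3 + 1) → Bool, (fun j => b j ^^ decide (Odd #(univ.filter fun i => ε i && a i j))) ∉ P :=
          fun ε => ws_flatPt_mem V h0 (· ∉ P) hPV' (3 + 1) b (hcos_out p hp b hb) a ha ε
        have h4 := hflat4 b a
        rw [sum_congr rfl fun ε _ => hp2 _ (hpts ε), ← mul_sum] at h4
        obtain ⟨k, hk⟩ := h4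
        exact ⟨k, by linarith⟩) with hev | hbig
    · have := hev p (mem_image.2 ⟨zeroVec, h0, bxor_zeroVec p⟩)
      apply hp4
      obtain ⟨k, hk⟩ := this
      exact ⟨k, by rw [hp2 p hp, hk]; ring⟩
    · have hT := hoff_count ((V.image (bxor p)).filter fun x => Odd (e x / 2)) 4
        (fun x hx => hcos_out p hp x (mem_filter.1 hx).1) (fun x hx => by
          have hx' := (mem_filter.1 hx)
          have hxP : x ∉ P := hcos_out p hp x hx'.1
          have h0' := Int.odd_iff.1 hx'.2
          have h2 := hp2 x hxP
          have : e x ≤ -2 ∨ 2 ≤ e x := by omega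
          have := tp_sq_ge (k := 2) (by norm_num) this
          linarith)
      norm_num at hbig
      have : (256 : ℤ) ≤ #((V.image (bxor p)).filter fun x => Odd (e x / 2)) := by exact_mod_cast (by omega)
      linarith
  -- round 2: `8 ∣ e` off `P`
  have hdiv8 : ∀ y, y ∉ P → (8 : ℤ) ∣ e y := by
    by_contra hcon
    push Not at hcon
    obtain ⟨p, hp, hp8⟩ := hcon
    have hp4 : ∀ y, y ∉ P → e y = 4 * (e y / 4) := fun y hy => (Int.mul_ediv_cancel' (hdiv4 y hy)).symm
    rcases ws_erm_round V h0 hadd hcardV p (fun y => e y / 4) 4 (fun b hb a ha => by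
        have hpts : ∀ ε : Fin (4 + 1) → Bool, (fun j => b j ^^ decide (Odd #(univ.filter fun i => ε i && a i j))) ∉ P :=
          fun ε => ws_flatPt_mem V h0 (· ∉ P) hPV' (4 + 1) b (hcos_out p hp b hb) a ha ε
        have h8 := hflat5 b a
        rw [sum_congr rfl fun ε _ => hp4 _ (hpts ε), ← mul_sum] at h8
        obtain ⟨k, hk⟩ := h8
        exact ⟨k, by linarith⟩) with hev | hbig
    · have := hev p (mem_image.2 ⟨zeroVec, h0, bxor_zeroVec p⟩)
      apply hp8
      obtain ⟨k, hk⟩ := this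
      exact ⟨k, by rw [hp4 p hp, hk]; ring⟩
    · have hT := hoff_count ((V.image (bxor p)).filter fun x => Odd (e x / 4)) 16
        (fun x hx => hcos_out p hp x (mem_filter.1 hx).1) (fun x hx => by
          have hx' := (mem_filter.1 hx)
          have hxP : x ∉ P := hcos_out p hp x hx'.1
          have h0' := Int.odd_iff.1 hx'.2
          have h2 := hp4 x hxP
          have : e x ≤ -4 ∨ 4 ≤ e x := by omega
          have := tp_sq_ge (k := 4) (by norm_num) this
          linarith)
      norm_num at hbig
      have : (128 : ℤ) ≤ #((V.image (bxor p)).filter fun x => Odd (e x / 4)) := by exact_mod_cast (by omega)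
      linarith
  -- round 3: `16 ∣ e` off `P`
  have hdiv16 : ∀ y, y ∉ P → (16 : ℤ) ∣ e y := by
    by_contra hcon
    push Not at hcon
    obtain ⟨p, hp, hp16⟩ := hcon
    have hp8 : ∀ y, y ∉ P → e y = 8 * (e y / 8) := fun y hy => (Int.mul_ediv_cancel' (hdiv8 y hy)).symm
    rcases ws_erm_round V h0 hadd hcardV p (fun y => e y / 8) 6 (fun b hb a ha => by
        have hpts : ∀ ε : Fin (6 + 1) → Bool, (fun j => b j ^^ decide (Odd #(univ.filter fun i => ε i && a i j))) ∉ P :=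
          fun ε => ws_flatPt_mem V h0 (· ∉ P) hPV' (6 + 1) b (hcos_out p hp b hb) a ha ε
        have h16 := hflat7 b a
        rw [sum_congr rfl fun ε _ => hp8 _ (hpts ε), ← mul_sum] at h16
        obtain ⟨k, hk⟩ := h16
        exact ⟨k, by linarith⟩) with hev | hbig
    · have := hev p (mem_image.2 ⟨zeroVec, h0, bxor_zeroVec p⟩)
      apply hp16
      obtain ⟨k, hk⟩ := this
      exact ⟨k, by rw [hp8 p hp, hk]; ring⟩
    · have hT := hoff_count ((V.image (bxor p)).filter fun x => Odd (e x / 8)) 64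
        (fun x hx => hcos_out p hp x (mem_filter.1 hx).1) (fun x hx => by
          have hx' := (mem_filter.1 hx)
          have hxP : x ∉ P := hcos_out p hp x hx'.1
          have h0' := Int.odd_iff.1 hx'.2
          have h2 := hp8 x hxP
          have : e x ≤ -8 ∨ 8 ≤ e x := by omega
          have := tp_sq_ge (k := 8) (by norm_num) this
          linarith)
      norm_num at hbig
      have : (32 : ℤ) ≤ #((V.image (bxor p)).filter fun x => Odd (e x / 8)) := by exact_mod_cast (by omega)
      linarith
  -- final: `e = 0` off `P`
  intro y hy
  by_contra hne0
  obtain ⟨k, hk⟩ := hdiv16 y hy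
  have : e y ≤ -16 ∨ 16 ≤ e y := by omega
  have h256 := tp_sq_ge (k := 16) (by norm_num) this
  have := hoff_count {y} 256 (fun x hx => by rw [mem_singleton.1 hx]; exact hy) (fun x hx => by rw [mem_singleton.1 hx]; linarith)
  norm_num at this

end Summit.QuantumAdvantage.QuantumAdvantage.Theorems.CubicForrelation.NearExactIsExact

end
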